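import Literature.Topology.FourManifolds.ChargedHomotopySphere
import Literature.Topology.FourManifolds.BranchedDoubleCoverTwoKnot
import HarnessLib

/-!
# Charged homotopy spheres (Kuhrman 2025): the algebraic core of Theorem 1, proved

Topic `Literature/Topology/FourManifolds`; proofs sibling of `ChargedHomotopySphere.lean`, whose
single named fact `Kuhrman2025_thm3_chargedHomotopySphere` (Kuhrman 2025, Thm. 3: a homotopy
4-sphere with an involution fixing an embedded `S²` and preserving no metric of positive scalar
curvature) is **not** discharged here. Its printed proof (Kuhrman, arXiv:2507.03798, p. 11,
"Proof of Theorem 2 and Theorem 3") composes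

* Theorem 1 (the branched double covers `Σ₂(S⁴, ρK(2,3,|6s+1|))` of the roll-spun Montesinos
  knots are homotopy 4-spheres), with
* Miyazawa's real Seiberg–Witten degree `|deg|` (arXiv:2312.02041, Thm. 1.8), its value
  `4j ± 1 ≠ 1` on these knots (Kang–Park–Taniguchi, arXiv:2405.09295) and its triviality
  `|deg| = 1` for involutions preserving a metric of positive scalar curvature (Baraglia,
  Int. J. Math. 37 (2026), Prop. 1.3 (3); Miyazawa, proofs of Prop. 3.14 and Thm. 4.46).

Neither 2-knots and branched covers of `S⁴` nor any real Seiberg–Witten / Bauer–Furuta theory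
exists in Mathlib or in this tree, so the fact stays a cited hypothesis of its users. What this
file proves is the part of the printed argument that is pure group theory — the new algebraic
input of Kuhrman's Theorem 1 (p. 10, Prop. 4.2 and "Proof of Theorem 1"):

* `normalClosure_singleton_eq_top_of_commutator_eq_top` — **normal generation lifts through a
  perfect extension with cyclic kernel**: if `G` is perfect, `f : G →* Q` is onto with
  `ker f ≤ ⟨z⟩`, and `f m` normally generates `Q`, then `m` normally generates `G` (Kuhrman's
  "any element of `π` may be written as `zᵏ g` … `π/⟨⟨m⟩⟩` is cyclically generated by the image
  of `z`. Since `π` has trivial abelianization, it follows that `π` is normally generated by `m`",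
  with `π = π₁(Σ(2,3,|6s+1|))`, a central extension of the triangle group by `⟨z⟩`);
* `subsingleton_of_triangle_relations` — **Prop. 4.2 as an identity between relations**: in any
  group generated by `a, b, c` with `a² = b³ = cʳ = cab = 1`, `gcd(r, 6) = 1`, killing Kuhrman's
  element (3) (for `q = 3`) `y = c^{(r+1)/2} b⁻¹ a b c^{-(r+1)/2} a` kills everything; by the
  universal property this is `Δ(2,3,r)/⟨⟨y⟩⟩ = 1`, i.e. `y` normally generates the triangle group
  `Δ(2,3,r) = ⟨a, b, c ∣ a², b³, cʳ, cab⟩` (Kuhrman's proof verbatim: `b = (ca)⁻¹ = ac⁻¹` turns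
  `y` into `c^{(r+3)/2} a c^{-(r+3)/2} a`, so `a` commutes with `c^{(r+3)/2}`, hence with
  `c^{r+3} = c³`, hence with `c` as `gcd(3, r) = 1`; then the quotient is abelian and the
  abelianization of `Δ(2,3,r)` is trivial);
* `normalClosure_singleton_eq_top_of_triangle_quotient` — the two combined, the algebraic
  skeleton of "Proof of Theorem 1": a perfect group mapping onto such a triangle-relation group
  with cyclic kernel is normally generated by any lift `m` of `y`.

It also proves the GLUE step of the printed proof of Theorem 3 (route `ChargedHalfTurns`'
foreseen split `ChargedCover → ChargedSphere`), now that branched double covers of `S⁴` along a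
2-knot are typed (`IsBranchedDoubleCover`, file `BranchedDoubleCoverTwoKnot.lean`, whose
`exists_isSmoothEmbedding_fixedPoints` is the "fixed set = lifted 2-knot ≅ S²" input):

* `Kuhrman2025_thm3_chargedHomotopySphere_of_cover` — if some branched double cover `(X, ι, q)`
  of `S⁴` along a 2-knot is homotopy equivalent to `S⁴` and its deck involution preserves no
  metric of positive scalar curvature, then `Kuhrman2025_thm3_chargedHomotopySphere`. What it
  leaves are exactly the two unformalised inputs: Theorem 1 (`Σ₂(S⁴, ρK(2,3,|6s+1|)) ≃ₕ S⁴`) and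
  the real Seiberg–Witten obstruction (Baraglia 2026, Prop. 1.3 (3) with `|deg| = 4j ± 1 ≠ 1`).

What is deliberately NOT here (each would be a theory, see the seat's census): the
identification `π₁(Σ(2,3,r)) ↠ Δ(2,3,r)` with central cyclic kernel (Seifert fibrations), the
hyperbolic-geometry identification of the class of the fixed knot with `y` (Kuhrman Prop. 4.1),
Cor. 3.4 (fundamental groups of branched covers of twist-roll spun knots), and everything on the
gauge-theoretic side. No definitions, no named facts; everything is a theorem.

## References

* J. Kuhrman, *More exotic `ℝℙ²`-knots and homotopy spheres*, arXiv:2507.03798 (2025), p. 10: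
  Prop. 4.2 and Proof of Theorem 1; p. 11: Proof of Theorems 2 and 3. [Kuhrman2025]
* J. Miyazawa, *A gauge theoretic invariant of embedded surfaces in 4-manifolds and exotic
  `P²`-knots*, arXiv:2312.02041 (2023), Thm. 1.8, Prop. 3.14, Thm. 4.44, Thm. 4.46. [Miyazawa2023]
* D. Baraglia, *Exotic embedded surfaces and involutions from Real Seiberg–Witten theory*,
  Int. J. Math. 37 (2026), Prop. 1.3 (3). [Baraglia2026]
-/

namespace Literature.Topology.FourManifolds

namespace Kuhrman2025

/-- **Normal generation lifts through a perfect extension with cyclic kernel** (Kuhrman 2025,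
Proof of Theorem 1, p. 10: "any element of `π` may be written as `zᵏg` for some `k ∈ ℤ`, where
`z ∈ π` is the generator of the center and `g` belongs to the normal subgroup generated by `m`.
Therefore, `π/⟨⟨m⟩⟩` is cyclically generated by the image of `z`. Since `π` has trivial
abelianization, it follows that `π` is normally generated by `m`"). Abstract form: `G` perfect
(`commutator G = ⊤`), `f : G →* Q` surjective with kernel contained in a cyclic subgroup `⟨z⟩`,
and `f m` normally generating `Q` imply that `m` normally generates `G` (centrality of `z` is not
needed for this step). [cite: Kuhrman2025, Proof of Theorem 1 (p. 10)] -/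
theorem normalClosure_singleton_eq_top_of_commutator_eq_top {G Q : Type*} [Group G] [Group Q]
    (f : G →* Q) (hf : Function.Surjective f) (hperf : commutator G = ⊤) {z : G}
    (hker : f.ker ≤ Subgroup.zpowers z) {m : G}
    (hm : Subgroup.normalClosure ({f m} : Set Q) = ⊤) :
    Subgroup.normalClosure ({m} : Set G) = ⊤ := by
  set K : Subgroup G := Subgroup.normalClosure ({m} : Set G) with hK
  -- Step 1: `G = K · ⟨z⟩`.
  have hsup : K ⊔ Subgroup.zpowers z = ⊤ := by
    rw [eq_top_iff]
    intro g _
    have hg : f g ∈ K.map f := by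
      rw [hK, Subgroup.map_normalClosure _ f hf, Set.image_singleton, hm]
      exact Subgroup.mem_top _
    obtain ⟨k, hk, hfk⟩ := Subgroup.mem_map.mp hg
    have hkg : k⁻¹ * g ∈ Subgroup.zpowers z := by
      apply hker
      rw [MonoidHom.mem_ker, map_mul, map_inv, hfk, inv_mul_cancel]
    have : g = k * (k⁻¹ * g) := by group
    rw [this]
    exact Subgroup.mul_mem_sup hk hkg
  -- Step 2: `G ⧸ K` is generated by the image of `z`, hence commutative.
  set π : G →* G ⧸ K := QuotientGroup.mk' K with hπ
  have hπs : Function.Surjective π := QuotientGroup.mk'_surjective K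
  have htop : (⊤ : Subgroup (G ⧸ K)) = Subgroup.zpowers (π z) := by
    rw [← Subgroup.map_top_of_surjective π hπs, ← hsup, Subgroup.map_sup, hπ,
      QuotientGroup.map_mk'_self, bot_sup_eq, MonoidHom.map_zpowers]
  haveI : IsMulCommutative (G ⧸ K) := ⟨⟨fun x y => by
    have hx : x ∈ Subgroup.zpowers (π z) := htop ▸ Subgroup.mem_top x
    have hy : y ∈ Subgroup.zpowers (π z) := htop ▸ Subgroup.mem_top y
    obtain ⟨i, rfl⟩ := Subgroup.mem_zpowers_iff.mp hx
    obtain ⟨j, rfl⟩ := Subgroup.mem_zpowers_iff.mp hy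
    exact zpow_mul_comm _ i j⟩⟩
  -- Step 3: `G ⧸ K` is perfect (image of a perfect group) and commutative, hence trivial.
  have hcomm : commutator (G ⧸ K) = ⊤ := by
    rw [commutator_def, ← Subgroup.map_top_of_surjective π hπs, ← Subgroup.map_commutator,
      ← commutator_def, hperf]
  have hbot : commutator (G ⧸ K) = ⊥ := commutator_eq_bot (G ⧸ K)
  have htriv : ∀ x : G ⧸ K, x = 1 := fun x => by
    have hx : x ∈ commutator (G ⧸ K) := hcomm ▸ Subgroup.mem_top x
    rwa [hbot, Subgroup.mem_bot] at hx
  exact QuotientGroup.subgroup_eq_top_of_subsingleton K ⟨fun a b => by rw [htriv a, htriv b]⟩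

/-- **Kuhrman 2025, Prop. 4.2 (the algebra).** Let `gcd(r, 6) = 1` and let `a, b, c` generate a
group `H` and satisfy the triangle-group relations `a² = b³ = cʳ = cab = 1` of
`Δ(2, 3, r)`. If moreover Kuhrman's element (3) (with `q = 3`, so `b^{(q+1)/2} = b⁻¹`)
`y = c^{(r+1)/2} b⁻¹ a b c^{-(r+1)/2} a` is trivial in `H`, then `H` is trivial. Equivalently
(universal property of the presentation), `Δ(2,3,r)/⟨⟨y⟩⟩ = 1`: `y` normally generates
`Δ(2, 3, |6s+1|)` — the displayed computation in the proof of Prop. 4.2 (p. 10): "`b = (ca)⁻¹ =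
ac⁻¹`" gives "`y = c^{(r+3)/2} a c^{-(r+3)/2} a` and so in the quotient … `a` commutes with
`c^{(r+3)/2}` and hence also with `c^{r+3} = c³`. Since `(3, r) = 1`, `a` must also commute with
`c` … `Δ/⟨⟨y⟩⟩` is abelian. Since `Δ` has trivial abelianization, `y` must normally generate the
whole of `Δ`." (Here the last two sentences are run in `H` directly: `a, c` commute, so
`1 = b³ = (ac⁻¹)³ = a c⁻³` gives `a = c³`, `c⁶ = a² = 1 = cʳ`, so `c = a = b = 1`.)
[cite: Kuhrman2025, Prop. 4.2 (p. 10)] -/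
theorem subsingleton_of_triangle_relations {H : Type*} [Group H] {r : ℕ} (hr : Nat.Coprime r 6)
    {a b c : H} (ha : a ^ 2 = 1) (hb : b ^ 3 = 1) (hc : c ^ r = 1) (hcab : c * a * b = 1)
    (hy : c ^ ((r + 1) / 2) * b⁻¹ * a * b * (c ^ ((r + 1) / 2))⁻¹ * a = 1)
    (hgen : Subgroup.closure ({a, b, c} : Set H) = ⊤) : Subsingleton H := by
  have hr2 : Nat.Coprime r 2 := Nat.Coprime.coprime_dvd_right (by norm_num : 2 ∣ 6) hr
  have hr3 : Nat.Coprime r 3 := Nat.Coprime.coprime_dvd_right (by norm_num : 3 ∣ 6) hr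
  have hodd : Odd r := Nat.coprime_two_right.mp hr2
  -- `a⁻¹ = a` and `b = (ca)⁻¹ = a c⁻¹`.
  have haa : a * a = 1 := by rw [← pow_two, ha]
  have ha' : a⁻¹ = a := inv_eq_iff_mul_eq_one.mpr haa
  have hb' : b = a * c⁻¹ := by
    rw [eq_inv_of_mul_eq_one_right hcab, mul_inv_rev, ha']
  -- `b⁻¹ a b = c a c⁻¹`, so `y = c^{n+1} a c^{-(n+1)} a` with `n = (r+1)/2`.
  have hconj : b⁻¹ * a * b = c * a * c⁻¹ := by
    rw [hb', mul_inv_rev, inv_inv, ha']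
    calc c * a * a * (a * c⁻¹) = c * (a * a) * a * c⁻¹ := by group
      _ = c * a * c⁻¹ := by rw [haa, mul_one]
  set n : ℕ := (r + 1) / 2 with hn
  have hy' : c ^ (n + 1) * a * (c ^ (n + 1))⁻¹ * a = 1 := by
    have h1 : c ^ n * b⁻¹ * a * b * (c ^ n)⁻¹ * a = c ^ n * (b⁻¹ * a * b) * (c ^ n)⁻¹ * a := by
      group
    rw [h1, hconj] at hy
    calc c ^ (n + 1) * a * (c ^ (n + 1))⁻¹ * a
        = c ^ n * (c * a * c⁻¹) * (c ^ n)⁻¹ * a := by rw [pow_succ]; group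
      _ = 1 := hy
  -- `a` commutes with `c^{n+1}`, hence with `c^{2(n+1)} = c^{r+3} = c³`.
  have hcomm1 : Commute (c ^ (n + 1)) a := by
    have h1 : c ^ (n + 1) * a * (c ^ (n + 1))⁻¹ = a := by
      have h0 := eq_inv_of_mul_eq_one_left hy'
      rwa [ha'] at h0
    calc c ^ (n + 1) * a = c ^ (n + 1) * a * (c ^ (n + 1))⁻¹ * c ^ (n + 1) := by group
      _ = a * c ^ (n + 1) := by rw [h1]
  have h2n : (n + 1) * 2 = r + 3 := by
    obtain ⟨k, hk⟩ := hodd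
    omega
  have hcomm3 : Commute (c ^ 3) a := by
    have h := hcomm1.pow_left 2
    rwa [← pow_mul, h2n, pow_add, hc, one_mul] at h
  -- `gcd(3, r) = 1`: `c = (c³)^u` for a Bézout coefficient `u`, so `a` commutes with `c`.
  have hcommc : Commute c a := by
    have hg : ((Nat.gcd 3 r : ℕ) : ℤ) = (3 : ℕ) * Nat.gcdA 3 r + (r : ℕ) * Nat.gcdB 3 r :=
      Nat.gcd_eq_gcd_ab 3 r
    rw [Nat.Coprime.gcd_eq_one hr3.symm] at hg
    have hc' : c = (c ^ 3) ^ Nat.gcdA 3 r := by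
      conv_lhs => rw [← zpow_one c]
      rw [show (1 : ℤ) = ((1 : ℕ) : ℤ) by norm_num, hg, zpow_add, zpow_mul, zpow_mul,
        zpow_natCast, zpow_natCast, hc, one_zpow, mul_one]
    rw [hc']
    exact hcomm3.zpow_left _
  -- Now `1 = b³ = (ac⁻¹)³ = a³c⁻³ = ac⁻³`, so `a = c³`, `c⁶ = 1 = cʳ`, `c = 1`, `a = b = 1`.
  have hac : a = c ^ 3 := by
    have h3 : a ^ 3 = a := by rw [pow_succ, ha, one_mul]
    rw [hb', (hcommc.symm.inv_right).mul_pow, inv_pow, h3] at hb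
    exact mul_inv_eq_one.mp hb
  have hc6 : c ^ 6 = 1 := by
    have h : (c ^ 3) ^ 2 = 1 := by rw [← hac]; exact ha
    rwa [← pow_mul] at h
  have hc1 : c = 1 := by
    have h := pow_gcd_eq_one.mpr ⟨hc, hc6⟩
    rwa [Nat.Coprime.gcd_eq_one hr, pow_one] at h
  have ha1 : a = 1 := by rw [hac, hc1, one_pow]
  have hb1 : b = 1 := by rw [hb', ha1, hc1, inv_one, mul_one]
  have htop : (⊤ : Subgroup H) = ⊥ := by
    rw [← hgen, Subgroup.closure_eq_bot_iff]
    rintro x (rfl | rfl | rfl)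
    · exact ha1
    · exact hb1
    · exact hc1
  exact ⟨fun x y => by
    have hx : x ∈ (⊤ : Subgroup H) := Subgroup.mem_top x
    have hy₂ : y ∈ (⊤ : Subgroup H) := Subgroup.mem_top y
    rw [htop, Subgroup.mem_bot] at hx hy₂
    rw [hx, hy₂]⟩

/-- **Kuhrman 2025, Proof of Theorem 1 (algebraic skeleton).** Let `G` be a perfect group mapping
onto a group `H` generated by `a, b, c` with the triangle relations `a² = b³ = cʳ = cab = 1`,
`gcd(r, 6) = 1`, with kernel inside a cyclic subgroup `⟨z⟩`, and let `m ∈ G` lift Kuhrman's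
element `y = c^{(r+1)/2} b⁻¹ a b c^{-(r+1)/2} a`. Then `m` normally generates `G`. In print:
`G = π₁(Σ(2,3,|6s+1|))`, a central extension of `Δ = Δ(2,3,|6s+1|)` by its center `⟨z⟩`
(trivial abelianization), `H = Δ`, `m` the class of the fixed knot — "By Proposition 4.2, the
image of `m` normally generates `Δ` … it follows that `π` is normally generated by `m`. The
theorem then follows from Corollary 3.4." The topological identifications (Seifert fibration of
the Brieskorn sphere, Prop. 4.1, Cor. 3.4) are not formalised; this is
`subsingleton_of_triangle_relations` fed into
`normalClosure_singleton_eq_top_of_commutator_eq_top`.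
[cite: Kuhrman2025, Proof of Theorem 1 (p. 10)] -/
theorem normalClosure_singleton_eq_top_of_triangle_quotient {G H : Type*} [Group G] [Group H]
    {r : ℕ} (hr : Nat.Coprime r 6) (f : G →* H) (hf : Function.Surjective f)
    (hperf : commutator G = ⊤) {z : G} (hker : f.ker ≤ Subgroup.zpowers z) {a b c : H}
    (ha : a ^ 2 = 1) (hb : b ^ 3 = 1) (hc : c ^ r = 1) (hcab : c * a * b = 1)
    (hgen : Subgroup.closure ({a, b, c} : Set H) = ⊤) {m : G}
    (hm : f m = c ^ ((r + 1) / 2) * b⁻¹ * a * b * (c ^ ((r + 1) / 2))⁻¹ * a) :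
    Subgroup.normalClosure ({m} : Set G) = ⊤ := by
  refine normalClosure_singleton_eq_top_of_commutator_eq_top f hf hperf hker ?_
  -- `H ⧸ ⟨⟨f m⟩⟩` satisfies the hypotheses of Prop. 4.2 with `y = 1`, hence is trivial.
  set N : Subgroup H := Subgroup.normalClosure ({f m} : Set H) with hN
  set π : H →* H ⧸ N := QuotientGroup.mk' N with hπ
  have hπs : Function.Surjective π := QuotientGroup.mk'_surjective N
  have hyN : π (f m) = 1 := by
    rw [hπ, QuotientGroup.mk'_apply, QuotientGroup.eq_one_iff]
    exact Subgroup.subset_normalClosure (Set.mem_singleton _)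
  have hgen' : Subgroup.closure ({π a, π b, π c} : Set (H ⧸ N)) = ⊤ := by
    rw [← Subgroup.map_top_of_surjective π hπs, ← hgen, MonoidHom.map_closure,
      Set.image_insert_eq, Set.image_insert_eq, Set.image_singleton]
  have hsub : Subsingleton (H ⧸ N) :=
    subsingleton_of_triangle_relations (a := π a) (b := π b) (c := π c) hr
      (by rw [← map_pow, ha, map_one]) (by rw [← map_pow, hb, map_one])
      (by rw [← map_pow, hc, map_one]) (by rw [← map_mul, ← map_mul, hcab, map_one])
      (by simpa only [map_mul, map_pow, map_inv, hm] using hyN) hgen'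
  exact QuotientGroup.subgroup_eq_top_of_subsingleton N hsub

end Kuhrman2025

/-! ## Glue: Theorem 3 from a charged branched double cover (`ChargedCover → ChargedSphere`) -/

section Glue

open scoped Manifold ContDiff
open Literature.Geometry.Lorentzian

/-- **Kuhrman 2025, Thm. 3 from a charged branched double cover** (the glue step
`ChargedCover → ChargedSphere` of route `ChargedHalfTurns`' foreseen split of its supply crux).
If some branched double cover `(X, ι, q)` of `S⁴` along a 2-knot `K`
(`IsBranchedDoubleCover (𝓡 4) X K ι q`, file `BranchedDoubleCoverTwoKnot.lean`), with `X` a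
Hausdorff second-countable `C^∞` 4-manifold on `ℝ⁴`, is homotopy equivalent to `S⁴` and its deck
involution `ι` preserves no Riemannian metric of positive scalar curvature, then
`Kuhrman2025_thm3_chargedHomotopySphere` holds: the witnesses are `M = X`, `ι`, and the lifted
knot `e : S² ↪ X` (`IsBranchedDoubleCover.exists_isSmoothEmbedding_fixedPoints`: the fixed-point
set of the deck involution is a smoothly embedded 2-sphere), with `ι` smooth and `ι ∘ ι = id`
from the predicate. In print the hypotheses are Kuhrman's Thm. 1 (`X = Σ₂(S⁴, ρK(2,3,|6s+1|))`
is a homotopy 4-sphere) and the real Seiberg–Witten argument of the Proof of Thms. 2–3 (p. 11)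
with Baraglia (2026), Prop. 1.3 (3) (no `ι`-invariant PSC metric since `|deg| = 4j ± 1 ≠ 1`);
neither is formalised, so this theorem only isolates what remains.
[cite: Kuhrman2025, Proof of Theorems 2 and 3 (p. 11)] -/
theorem Kuhrman2025_thm3_chargedHomotopySphere_of_cover {X : Type} [TopologicalSpace X]
    [T2Space X] [SecondCountableTopology X] [ChartedSpace (EuclideanSpace ℝ (Fin 4)) X]
    [IsManifold (𝓡 4) ∞ X]
    {K : TwoKnot} {ι : X → X} {q : X → Metric.sphere (0 : EuclideanSpace ℝ (Fin 5)) 1}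
    (h : IsBranchedDoubleCover (𝓡 4) X K ι q)
    (he : ContinuousMap.HomotopyEquiv X (Metric.sphere (0 : EuclideanSpace ℝ (Fin 5)) 1))
    (hpsc : ∀ (g : PseudoRiemannianMetric (𝓡 4) ∞ (EuclideanSpace ℝ (Fin 4))
      (TangentSpace (𝓡 4) : X → Type _))
      (_ : g.HasLeviCivita), g.IsRiemannian → (∀ x, 0 < g.scalarCurvature x) →
        ¬ ∀ y, pullbackBilin (I := 𝓡 4) (I' := 𝓡 4) ι g.val y = g.val y) :
    Kuhrman2025_thm3_chargedHomotopySphere := by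
  obtain ⟨e, hemb, hfix, -⟩ := h.exists_isSmoothEmbedding_fixedPoints
  exact ⟨X, inferInstance, inferInstance, inferInstance, inferInstance, inferInstance, he, ι, e,
    h.contMDiff_deck, h.deck_comp_deck, hemb, hfix, hpsc⟩

end Glue

end Literature.Topology.FourManifolds
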